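import Summits.Ventures.WeilGRH.DualTrigKernelCheck
import Summits.Ventures.WeilGRH.DualTrigKernelTaylor
import HarnessLib

/-!
# Format D-K soundness, part 3: interval plumbing for the trigonometric part of a cell

Cell `rh-explicit`, WEIL TRACK — GRH ARM, route B (weil-grh-3).  For the kernel checker of
`DualTrigKernelDefs/Check.lean`: the MEMBERSHIP lemmas connecting the integer computations
(`powList`, `absUp`, `rotUV`, `mulPow`, `addTerm`, `moments`, `periodicMom`, `coeffs`,
`scaleCoeffs`, `hornerZ`, `innerLo`, `remTerm`, `remBlock`, `phase`/`tabGet`) with the real objects of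
`DualTrigKernelTaylor.lean` (`RTerm`, `moment`, `coefSum`, `remSum`, `sumVal`).  Main results:

* `DKCert.GRepr` — "the computed term `t : GTerm` encloses the real term `rt : RTerm`";
* `DKCert.moments_mem` — the moment accumulators enclose the real moments of the represented list
  (all terms / non-periodic terms);
* `DKCert.poly_ge_innerLo` — a polynomial with enclosed coefficients is `≥ innerLo / S` on
  `φ ∈ [−η⁺, η⁺]`;
* `DKCert.remSum_le_remBlock` — the Taylor remainder of the list is `≤ (remBlock).hi / S`.

Everything here is PROVED; no named facts, no `sorry`.
-/

noncomputable section

open Finset Real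

namespace Summit.Ventures.WeilGRH

open Literature.Analysis.ValidatedNumerics.NumericsMP
open DualTrigTaylor

namespace DKCert

variable {S : ℕ}

/-! ### Small interval facts -/

/-- `absUp I` is the thin interval of the number `absHi I / S ≥ |x|`. [folklore] -/
theorem mem_absUp (hS : 0 < S) (I : MI) : MI.mem S ((I.absHi : ℝ) / S) (absUp I) := by
  have hSr : (0 : ℝ) < S := by exact_mod_cast hS
  simp only [MI.mem, absUp, div_mul_cancel₀ _ hSr.ne']
  exact ⟨le_rfl, le_rfl⟩

/-- `|x| ≤ absHi I / S` for `x ∈ I`. [folklore] -/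
theorem abs_le_absUp (hS : 0 < S) {x : ℝ} {I : MI} (hx : MI.mem S x I) : |x| ≤ (I.absHi : ℝ) / S := by
  have hSr : (0 : ℝ) < S := by exact_mod_cast hS
  rw [le_div_iff₀ hSr]; exact MI.abs_le_absHi hx

/-- Membership transfers along `encl`. [folklore] -/
theorem mem_of_encl {I J : MI} (h : encl I J = true) {x : ℝ} (hx : MI.mem S x J) : MI.mem S x I := by
  simp only [encl, Bool.and_eq_true, decide_eq_true_eq] at h
  obtain ⟨h1, h2⟩ := hx
  exact ⟨le_trans (by exact_mod_cast h.1) h1, h2.trans (by exact_mod_cast h.2)⟩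

/-- A thin interval `⟨v, v⟩` contains `v / S`. [folklore] -/
theorem mem_thin (hS : 0 < S) (v : ℤ) : MI.mem S ((v : ℝ) / S) ⟨v, v⟩ := by
  have hSr : (0 : ℝ) < S := by exact_mod_cast hS
  simp only [MI.mem, div_mul_cancel₀ _ hSr.ne']
  exact ⟨le_rfl, le_rfl⟩

/-- Lower end: `I.lo / S ≤ x`. [folklore] -/
theorem lo_le (hS : 0 < S) {x : ℝ} {I : MI} (hx : MI.mem S x I) : (I.lo : ℝ) / S ≤ x :=
  MI.lo_div_le hS hx

/-- Upper end: `x ≤ I.hi / S`. [folklore] -/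
theorem le_hi (hS : 0 < S) {x : ℝ} {I : MI} (hx : MI.mem S x I) : x ≤ (I.hi : ℝ) / S :=
  MI.le_hi_div hS hx

/-- `hull` contains every value between a member of `I` and a member of `J`. [folklore] -/
theorem mem_hull_of_between {u v x : ℝ} {I J : MI} (hu : MI.mem S u I) (hv : MI.mem S v J)
    (h : (u ≤ x ∧ x ≤ v) ∨ (v ≤ x ∧ x ≤ u)) : MI.mem S x (I.hull J) := by
  have hS0 : (0 : ℝ) ≤ S := by positivity
  simp only [MI.mem, MI.hull, Int.cast_min, Int.cast_max] at hu hv ⊢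
  rcases h with ⟨h1, h2⟩ | ⟨h1, h2⟩
  · exact ⟨(min_le_left _ _).trans (hu.1.trans (by nlinarith)),
      (le_trans (by nlinarith) hv.2).trans (le_max_right _ _)⟩
  · exact ⟨(min_le_right _ _).trans (hv.1.trans (by nlinarith)),
      (le_trans (by nlinarith) hu.2).trans (le_max_left _ _)⟩

/-- `powList S X m` has `m+1` entries enclosing `x^0, …, x^m`. [folklore] -/
theorem powList_spec (hS : 0 < S) {x : ℝ} {X : MI} (hx : MI.mem S x X) :
    ∀ m : ℕ, (powList S X m).length = m + 1 ∧
      ∀ i ≤ m, MI.mem S (x ^ i) ((powList S X m).getD i dft)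
  | 0 => by
      refine ⟨rfl, fun i hi ↦ ?_⟩
      obtain rfl : i = 0 := Nat.le_zero.1 hi
      simpa [powList] using MI.mem_ofInt S 1
  | m + 1 => by
      obtain ⟨hlen, hmem⟩ := powList_spec hS hx m
      have hlast : (powList S X m).getLastD (MI.ofInt S 1) = (powList S X m).getD m dft := by
        rw [List.getLastD_eq_getLast?, List.getLast?_eq_getElem?, List.getD_eq_getElem?_getD, hlen]
        have h2 : (powList S X m)[m]? = some ((powList S X m)[m]'(by rw [hlen]; omega)) :=
          List.getElem?_eq_getElem _
        rw [show m + 1 - 1 = m by omega, h2]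
        rfl
      refine ⟨by simp [powList, hlen], fun i hi ↦ ?_⟩
      simp only [powList]
      rcases Nat.lt_or_eq_of_le hi with hlt | rfl
      · rw [List.getD_append _ _ _ _ (by rw [hlen]; omega)]
        exact hmem i (by omega)
      · rw [List.getD_eq_getElem?_getD, List.getElem?_append_right (by rw [hlen])]
        simp only [hlen, Nat.sub_self, List.getElem?_cons_zero, Option.getD_some]
        rw [hlast, pow_succ]
        exact MI.mem_mul hS (hmem m le_rfl) hx

/-! ### Represented terms -/

/-- The computed term `t` ENCLOSES the real term `rt` (to order `R`, at scale `S`): coefficients,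
frequency, the `2R+2` powers, and for integer-frequency terms the exact powers. [folklore] -/
structure GRepr (S R : ℕ) (t : GTerm) (rt : RTerm) : Prop where
  memA : MI.mem S rt.A t.A
  memB : MI.mem S rt.B t.B
  memK : MI.mem S rt.κ t.rI
  kpow : ∀ m ≤ 2 * R + 1, MI.mem S (rt.κ ^ m) (t.kpow.getD m dft)
  intK : t.isInt = true → rt.κ = t.k
  intPow : t.isInt = true → ∀ m ≤ 2 * R + 1, t.kpowZ.getD m 0 = (t.k : ℤ) ^ m

variable {c : DKCert}

/-- `mulPow` encloses `w κ^m`. [folklore] -/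
theorem mem_mulPow (hS : 0 < c.S) {t : GTerm} {rt : RTerm} (h : GRepr c.S c.R t rt) {w : ℝ} {W : MI}
    (hw : MI.mem c.S w W) {m : ℕ} (hm : m ≤ 2 * c.R + 1) :
    MI.mem c.S (w * rt.κ ^ m) (c.mulPow t W m) := by
  unfold mulPow
  by_cases hi : t.isInt = true
  · rw [if_pos hi, h.intPow hi m hm, h.intK hi]
    have := MI.mem_mulInt hw ((t.k : ℤ) ^ m)
    push_cast at this
    exact this
  · rw [if_neg hi]
    exact MI.mem_mul hS hw (h.kpow m hm)

/-- `rotUV` encloses the rotated coefficients `U`, `V` at a centre whose cosine/sine are enclosed by `Z`.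
[folklore] -/
theorem mem_rotUV (hS : 0 < c.S) {t : GTerm} {rt : RTerm} (h : GRepr c.S c.R t rt) {θc : ℝ} {Z : MC}
    (hcos : MI.mem c.S (Real.cos (rt.κ * θc)) Z.re) (hsin : MI.mem c.S (Real.sin (rt.κ * θc)) Z.im) :
    MI.mem c.S (rt.U θc) (c.rotUV t Z).1 ∧ MI.mem c.S (rt.V θc) (c.rotUV t Z).2 := by
  unfold rotUV
  by_cases hb : t.B.lo = 0 ∧ t.B.hi = 0
  · rw [if_pos hb]
    have hB0 : rt.B = 0 := by
      have hm := h.memB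
      simp only [MI.mem, hb.1, hb.2, Int.cast_zero] at hm
      have hSr : (0 : ℝ) < c.S := by exact_mod_cast hS
      nlinarith [hm.1, hm.2]
    constructor
    · have := MI.mem_mul hS h.memA hcos
      simpa [RTerm.U, hB0] using this
    · have := MI.mem_neg (MI.mem_mul hS h.memA hsin)
      simp only [RTerm.V, hB0, zero_mul, zero_sub]
      exact this
  · rw [if_neg hb]
    exact ⟨MI.mem_add (MI.mem_mul hS h.memA hcos) (MI.mem_mul hS h.memB hsin),
      MI.mem_sub (MI.mem_mul hS h.memB hcos) (MI.mem_mul hS h.memA hsin)⟩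

/-- A list of intervals encloses the moments `m < 2R` of a list of real terms at the centre `θc`.
[folklore] -/
def MomMem (c : DKCert) (rts : List RTerm) (θc : ℝ) (mom : List MI) : Prop :=
  ∀ m < 2 * c.R, MI.mem c.S (moment rts θc m) (mom.getD m dft)

/-- `zeroMom` encloses the moments of the empty list. [folklore] -/
theorem momMem_zero (θc : ℝ) : MomMem c [] θc c.zeroMom := by
  intro m hm
  simp only [moment_nil, zeroMom, List.getD_eq_getElem?_getD, List.getElem?_map, List.getElem?_range hm,
    Option.map_some, Option.getD_some]
  simpa using MI.mem_ofInt c.S 0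

/-- `addTerm` adds the moments of one represented term. [folklore] -/
theorem momMem_addTerm (hS : 0 < c.S) {t : GTerm} {rt : RTerm} (h : GRepr c.S c.R t rt) {θc : ℝ}
    {U V : MI} (hU : MI.mem c.S (rt.U θc) U) (hV : MI.mem c.S (rt.V θc) V)
    {rts : List RTerm} {mom : List MI} (hmom : MomMem c rts θc mom) :
    MomMem c (rt :: rts) θc (c.addTerm t U V mom) := by
  intro m hm
  simp only [addTerm, List.getD_eq_getElem?_getD, List.getElem?_map, List.getElem?_range hm,
    Option.map_some, Option.getD_some, moment_cons]
  rw [add_comm]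
  refine MI.mem_add ?_ ?_
  · have := hmom m hm; rwa [List.getD_eq_getElem?_getD] at this
  · have hW : MI.mem c.S (rt.W θc m) (if m % 2 = 0 then U else V) := by
      unfold RTerm.W; split_ifs <;> assumption
    exact mem_mulPow hS h hW (by omega)

/-- The centre phase: `tabGet` and the general `expI` path enclose `cos κθc`, `sin κθc`,
`θc = (2j+1)π/Mc`, provided the block table passed `tabOK` and `π ∈ piI`. [folklore] -/
theorem mem_phase (hS : 0 < c.S) (hpi : MI.mem c.S Real.pi c.piI) {b : DKBlock} (htab : c.tabOK b = true)
    (hMc : 1 ≤ b.Mc) {t : GTerm} {rt : RTerm} (h : GRepr c.S c.R t rt) (j : ℤ) {Z : MC}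
    (hZ : c.phase b j t = some Z) :
    MI.mem c.S (Real.cos (rt.κ * ((2 * j + 1) * π / b.Mc))) Z.re ∧
      MI.mem c.S (Real.sin (rt.κ * ((2 * j + 1) * π / b.Mc))) Z.im := by
  have hMcr : (0 : ℝ) < b.Mc := by exact_mod_cast hMc
  -- the table entries
  have htabmem : ∀ i : ℕ, i < b.Mc →
      MI.mem c.S (Real.cos (π * i / b.Mc)) (tabEntry b i).re ∧
        MI.mem c.S (Real.sin (π * i / b.Mc)) (tabEntry b i).im := by
    intro i hi
    unfold tabOK at htab
    rw [List.all_eq_true] at htab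
    have hi' := htab i (List.mem_range.2 hi)
    split at hi'
    · rename_i Zi hZi
      simp only [Bool.and_eq_true] at hi'
      have harg : MI.mem c.S (π * i / b.Mc) ((c.piI.mulInt i).divNat b.Mc) := by
        have := MI.mem_divNat (MI.mem_mulInt hpi (i : ℤ)) (n := b.Mc) (by omega)
        push_cast at this; exact this
      have hE := MC.mem_expI hS hpi hZi harg
      have hre : (Complex.exp (↑(π * ↑i / ↑b.Mc) * Complex.I)).re = Real.cos (π * i / b.Mc) := by
        rw [Complex.exp_ofReal_mul_I_re]
      have him : (Complex.exp (↑(π * ↑i / ↑b.Mc) * Complex.I)).im = Real.sin (π * i / b.Mc) := by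
        rw [Complex.exp_ofReal_mul_I_im]
      exact ⟨mem_of_encl hi'.1 (hre ▸ hE.1), mem_of_encl hi'.2 (him ▸ hE.2)⟩
    · simp at hi'
  unfold phase at hZ
  by_cases hint : t.isInt = true
  · rw [if_pos hint] at hZ
    simp only [Option.some.injEq] at hZ
    subst hZ
    rw [h.intK hint]
    -- reduce the angle modulo 2π
    set N : ℤ := (t.k : ℤ) * (2 * j + 1) with hN
    set M2 : ℤ := 2 * (b.Mc : ℤ) with hM2
    have hM2pos : 0 < M2 := by rw [hM2]; omega
    set i : ℤ := N % M2 with hi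
    have hi0 : 0 ≤ i := Int.emod_nonneg _ hM2pos.ne'
    have hiM : i < M2 := Int.emod_lt_of_pos _ hM2pos
    have hdiv : N = M2 * (N / M2) + i := by have := Int.emod_add_mul_ediv N M2; rw [hi]; linarith
    have hang : (t.k : ℝ) * ((2 * j + 1) * π / b.Mc) = π * (i.toNat : ℕ) / b.Mc + (N / M2 : ℤ) * (2 * π) := by
      have : ((i.toNat : ℕ) : ℝ) = (i : ℝ) := by exact_mod_cast Int.toNat_of_nonneg hi0
      rw [this]
      have hN' : (t.k : ℝ) * (2 * j + 1) = (N : ℝ) := by rw [hN]; push_cast; ring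
      have hd : (N : ℝ) = (M2 : ℝ) * ((N / M2 : ℤ) : ℝ) + (i : ℝ) := by exact_mod_cast hdiv
      rw [show (t.k : ℝ) * ((2 * j + 1) * π / b.Mc) = (t.k : ℝ) * (2 * j + 1) * π / b.Mc by ring, hN', hd, hM2]
      push_cast
      field_simp
      ring
    rw [hang, Real.cos_add_int_mul_two_pi, Real.sin_add_int_mul_two_pi]
    unfold tabGet
    have hiNat : i.toNat < 2 * b.Mc := by
      have : (i.toNat : ℤ) < M2 := by rw [Int.toNat_of_nonneg hi0]; exact hiM
      omega
    by_cases hlt : i.toNat < b.Mc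
    · rw [if_pos hlt]; exact htabmem _ hlt
    · rw [if_neg hlt]
      have hsub : i.toNat - b.Mc < b.Mc := by omega
      obtain ⟨hc, hs⟩ := htabmem _ hsub
      have hang2 : π * (i.toNat : ℕ) / b.Mc = π * ((i.toNat - b.Mc : ℕ) : ℝ) / b.Mc + π := by
        have : ((i.toNat - b.Mc : ℕ) : ℝ) = (i.toNat : ℝ) - b.Mc := by
          rw [Nat.cast_sub (by omega)]
        rw [this]; field_simp; ring
      rw [hang2, Real.cos_add_pi, Real.sin_add_pi]
      exact ⟨MI.mem_neg hc, MI.mem_neg hs⟩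
  · rw [if_neg hint] at hZ
    have harg : MI.mem c.S (rt.κ * ((2 * j + 1) * π / b.Mc))
        (MI.mul c.S t.rI ((c.piI.mulInt (2 * j + 1)).divNat b.Mc)) := by
      have h1 := MI.mem_divNat (MI.mem_mulInt hpi (2 * j + 1)) (n := b.Mc) (by omega)
      have h2 := MI.mem_mul hS h.memK h1
      convert h2 using 1
      push_cast; ring
    have hE := MC.mem_expI hS hpi hZ harg
    have h1 := hE.1
    have h2 := hE.2
    rw [Complex.exp_ofReal_mul_I_re] at h1
    rw [Complex.exp_ofReal_mul_I_im] at h2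
    exact ⟨h1, h2⟩

/-- The real terms represented by the NON-periodic computed terms (in order). [folklore] -/
def ncList : List GTerm → List RTerm → List RTerm
  | t :: ts, r :: rs => if t.comm then ncList ts rs else r :: ncList ts rs
  | _, _ => []

/-- The real terms represented by the PERIODIC computed terms (in order). [folklore] -/
def cList : List GTerm → List RTerm → List RTerm
  | t :: ts, r :: rs => if t.comm then r :: cList ts rs else cList ts rs
  | _, _ => []

/-- The moments split: `moment (cList) = moment all − moment (ncList)`. [folklore] -/
theorem moment_cList : ∀ (ts : List GTerm) (rts : List RTerm), List.Forall₂ (GRepr c.S c.R) ts rts →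
    ∀ (θc : ℝ) (m : ℕ), moment (cList ts rts) θc m = moment rts θc m - moment (ncList ts rts) θc m
  | _, _, List.Forall₂.nil, θc, m => by simp [cList, ncList]
  | _, _, @List.Forall₂.cons _ _ _ t rt ts rts _ hF, θc, m => by
      have ih := moment_cList ts rts hF θc m
      by_cases h : t.comm = true
      · simp [cList, ncList, h, ih]; ring
      · simp [cList, ncList, h, ih]

/-- The value split: `sumVal (cList) = sumVal all − sumVal (ncList)`. [folklore] -/
theorem sumVal_cList : ∀ (ts : List GTerm) (rts : List RTerm), List.Forall₂ (GRepr c.S c.R) ts rts →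
    ∀ θ : ℝ, sumVal (cList ts rts) θ = sumVal rts θ - sumVal (ncList ts rts) θ
  | _, _, List.Forall₂.nil, θ => by simp [cList, ncList]
  | _, _, @List.Forall₂.cons _ _ _ t rt ts rts _ hF, θ => by
      have ih := sumVal_cList ts rts hF θ
      by_cases h : t.comm = true
      · simp [cList, ncList, h, ih]; ring
      · simp [cList, ncList, h, ih]

/-- **The moment accumulators enclose the real moments.**  If every computed term encloses a real
term (`List.Forall₂`), then `moments b j ts = some (accA, accN)` encloses the moments of all terms and
of the non-periodic ones, at the centre `θc = (2j+1)π/Mc`. [folklore] -/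
theorem moments_mem (hS : 0 < c.S) (hpi : MI.mem c.S Real.pi c.piI) {b : DKBlock} (htab : c.tabOK b = true)
    (hMc : 1 ≤ b.Mc) (j : ℤ) :
    ∀ {ts : List GTerm} {rts : List RTerm}, List.Forall₂ (GRepr c.S c.R) ts rts →
      ∀ {acc : List MI × List MI}, c.moments b j ts = some acc →
        MomMem c rts ((2 * j + 1) * π / b.Mc) acc.1 ∧
          MomMem c (ncList ts rts) ((2 * j + 1) * π / b.Mc) acc.2 := by
  intro ts rts hF
  induction hF with
  | nil =>
      intro acc hacc
      simp only [moments, Option.some.injEq] at hacc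
      subst hacc
      exact ⟨momMem_zero _, by simpa [ncList] using momMem_zero (c := c) _⟩
  | @cons t rt ts rts hh hF ih =>
      intro acc hacc
      cases hrec : c.moments b j ts with
      | none => simp [moments, hrec] at hacc
      | some acc' =>
        obtain ⟨accA, accN⟩ := acc'
        obtain ⟨ihA, ihN⟩ := ih hrec
        cases hZ : c.phase b j t with
        | none => simp [moments, hrec, hZ] at hacc
        | some Z =>
          simp only [moments, hrec, hZ, Option.some.injEq] at hacc
          subst hacc
          obtain ⟨hc, hs⟩ := mem_phase hS hpi htab hMc hh j hZ
          obtain ⟨hU, hV⟩ := mem_rotUV hS hh hc hs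
          refine ⟨momMem_addTerm hS hh hU hV ihA, ?_⟩
          by_cases hcomm : t.comm = true
          · simpa [ncList, hcomm] using ihN
          · simpa [ncList, hcomm] using momMem_addTerm hS hh hU hV ihN

/-- `periodicMom` encloses the moments of the periodic terms. [folklore] -/
theorem periodicMom_mem {ts : List GTerm} {rts : List RTerm} (hF : List.Forall₂ (GRepr c.S c.R) ts rts)
    {θc : ℝ} {acc : List MI × List MI} (hA : MomMem c rts θc acc.1) (hN : MomMem c (ncList ts rts) θc acc.2) :
    MomMem c (cList ts rts) θc (c.periodicMom acc) := by
  intro m hm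
  simp only [periodicMom, List.getD_eq_getElem?_getD, List.getElem?_map, List.getElem?_range hm,
    Option.map_some, Option.getD_some, moment_cList ts rts hF]
  have h1 := hA m hm; have h2 := hN m hm
  rw [List.getD_eq_getElem?_getD] at h1 h2
  exact MI.mem_sub h1 h2

end DKCert

end Summit.Ventures.WeilGRH

end
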